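import Summits.QuantumFields.BalabanUV.T4Continuum.Spine.CovariantAveragingTower
import Summits.QuantumFields.BalabanUV.T4Continuum.Support.VariationalGradientDuality

/-!
# T⁴ programme, spine node NE2 (U1a), lane P2 — THE MONOTONE TOWER: a tower of Hermitian matrices with nonnegative forms and ONE-SIDED summable brackets
# `X_{k+1} ≤ X_k + e′_k` CONVERGES, and its forms have bounded total variation (abstract; cell `pub-balaban`)

NE2 formalisation swarm `b2b-balaban-t4-ne2-formalise-*`, leaf prover 10 GEN 3 (`prover-b2b-balaban-t4-ne2-formalise-leaf-10-g3-0`, V-END holder lineage); journal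
INTENT «THE MONOTONE END» CLAIMS.log 2026-08-20 16:10Z l.16875, module (M1).  Elementary real analysis + matrix bookkeeping; nothing about Bałaban's objects.

WHY.  The vector END of road P2 (`VariationalVectorTower.towerLimitRate_effV_of_pairs`, p218948, and its descendants) turns TWO-SIDED per-level brackets with GEOMETRIC
defects into `TowerLimitRate` (limit + rate).  With background the LOWER bracket's slice law is a located obstruction ∕ open leaf (leaf-01-g7's memo
`t4/T4-EST-NE2-P2-VGF.md` §5), while the UPPER bracket `Δ_{k+1}(φ) ≤ Δ_k(φ) + e′_k·‖φ‖²` needs only the coarse minimiser, (ONE-min), V-REG, V-P, V-UB.  This file records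
that the upper bracket ALONE already gives EXISTENCE of the limit (no rate): in the Loewner order `0 ≤ X_{k+1} ≤ X_k + e′_k·N` with `Σ e′_k < ∞` is a monotone bounded
tower.
 * §1 real sequences: `tendsto_of_le_add_summable` (`0 ≤ f`, `f (k+1) ≤ f k + e k`, `0 ≤ e`, partial sums of `e` bounded ⟹ `f` converges), `tv_le_of_le_add`
   (total variation `Σ_{k<K} |f k − f (k+1)| ≤ f 0 + 2S`).
 * §2 Hermitian bookkeeping: the polarisation of the sesquilinear form `star v ⬝ᵥ H *ᵥ w` against the real form `qform` is leaf-03-g5's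
   `VariationalGradientDuality.qform_add_vec` ∕ `qform_add_smul_vec` (p222308) BY NAME; here only the ENTRY IDENTITIES `re (H i j) = (q(eᵢ+eⱼ) − q eᵢ − q eⱼ)∕2`, `im (H i j) = (q eᵢ + q eⱼ − q(eᵢ + I•eⱼ))∕2` for Hermitian `H`.
 * §3 **`exists_tendsto_of_upper_brackets`**: Hermitian `X k` with `0 ≤ qform (X k) v` and `qform (X (k+1)) v ≤ qform (X k) v + e k·N v` (`0 ≤ N`, `0 ≤ e`, bounded partial
   sums) ⟹ `∃ X∞, Tendsto X atTop (𝓝 X∞)` (product topology = the `ℓ²`-operator-norm topology on a finite index), `X∞` Hermitian with `0 ≤ qform X∞ v`, the forms converge,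
   **`tv_qform_le`**: `Σ_{k<K} |qform (X k) v − qform (X (k+1)) v| ≤ qform (X 0) v + 2S·N v`, and **`tv_entry_le`**: every ENTRY has bounded total variation
   (`Σ_k ‖X k i j − X (k+1) i j‖` bounded explicitly) — absolutely summable increments, no rate.
The vector-letter instance (existence of the limit of `effV` along `n_k = L^k` from (ONE-min) + V-REG + V-P + V-UB, no slice law, no Federbush) is module (M2)
`VariationalVectorEndMonotone`.

HONEST FRAMING (T4-DAG p. 1).  [folklore] (monotone convergence of bounded self-adjoint sequences, finite-dimensional form); nothing printed is a hypothesis; no `def … : Prop`,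
no `def`, no `sorry`; axioms standard.  Nothing with background is discharged; V-END with background ∕ NE2 NOT proved;
NE3 OPEN; spine PROVED 0∕9 unchanged; rung (B)+1 on a fixed finite T⁴ — NOT infinite volume, NOT mass gap, NOT Clay.  HONEST DEPENDENCY (cell, verbatim): continuum YM on T⁴ ⇐
BetaPertH ∧ nine spine estimates (0/9 proved); BetaPertH ⇐ (D1) ∧ (D4) ∧ CAP+tail; G-an2-4 gates asym, D1 and NE2/3/4.
-/

noncomputable section

namespace Summit.QuantumFields.BalabanUV.T4Continuum.VariationalMonotoneTower

open Finset Filter Matrix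
open scoped Topology ComplexConjugate ComplexOrder BigOperators
open Literature.Analysis.Complex (qform qform_sub)
open Summit.QuantumFields.BalabanUV.T4Continuum.VariationalGradientDuality (qform_add_vec qform_add_smul_vec)

/-! ## §1 Real sequences with one-sided summable steps -/

/-- `|a − b| ≤ (a − b) + 2e` whenever `b ≤ a + e`, `0 ≤ e`. [folklore] -/
theorem abs_sub_le_sub_add (a b e : ℝ) (h : b ≤ a + e) (he : 0 ≤ e) : |a - b| ≤ (a - b) + 2 * e := by
  rcases le_or_gt b a with hab | hab
  · rw [abs_of_nonneg (sub_nonneg.mpr hab)]; linarith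
  · rw [abs_of_neg (sub_neg.mpr hab)]; linarith

/-- **Monotone convergence with summable one-sided steps**: `0 ≤ f`, `f (k+1) ≤ f k + e k`, `0 ≤ e k`, `Σ_{j<K} e j ≤ S` for all `K` ⟹ `f` converges. [folklore] -/
theorem tendsto_of_le_add_summable {f e : ℕ → ℝ} {S : ℝ} (hf0 : ∀ k, 0 ≤ f k) (he0 : ∀ k, 0 ≤ e k)
    (hS : ∀ K, ∑ j ∈ range K, e j ≤ S) (hstep : ∀ k, f (k + 1) ≤ f k + e k) :
    ∃ l : ℝ, Tendsto f atTop (𝓝 l) := by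
  -- `g k := f k − Σ_{j<k} e j` is antitone and bounded below by `−S`
  set g : ℕ → ℝ := fun k => f k - ∑ j ∈ range k, e j with hg
  have hanti : Antitone g := by
    refine antitone_nat_of_succ_le fun k => ?_
    simp only [hg, sum_range_succ]
    linarith [hstep k]
  have hbdd : BddBelow (Set.range g) := by
    refine ⟨-S, ?_⟩
    rintro _ ⟨k, rfl⟩
    simp only [hg]
    linarith [hf0 k, hS k]
  have hg_t : Tendsto g atTop (𝓝 (⨅ k, g k)) := tendsto_atTop_ciInf hanti hbdd
  -- the partial sums of `e` are monotone and bounded above by `S`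
  set p : ℕ → ℝ := fun k => ∑ j ∈ range k, e j with hp
  have hmono : Monotone p := by
    refine monotone_nat_of_le_succ fun k => ?_
    simp only [hp, sum_range_succ]
    linarith [he0 k]
  have hbdd' : BddAbove (Set.range p) := ⟨S, by rintro _ ⟨k, rfl⟩; exact hS k⟩
  have hp_t : Tendsto p atTop (𝓝 (⨆ k, p k)) := tendsto_atTop_ciSup hmono hbdd'
  refine ⟨(⨅ k, g k) + ⨆ k, p k, ?_⟩
  have e1 : f = fun k => g k + p k := funext fun k => by simp only [hg, hp]; ring
  rw [e1]
  exact hg_t.add hp_t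

/-- **Total variation**: under the same hypotheses `Σ_{k<K} |f k − f (k+1)| ≤ f 0 + 2S` for every `K`. [folklore] -/
theorem tv_le_of_le_add {f e : ℕ → ℝ} {S : ℝ} (hf0 : ∀ k, 0 ≤ f k) (he0 : ∀ k, 0 ≤ e k)
    (hS : ∀ K, ∑ j ∈ range K, e j ≤ S) (hstep : ∀ k, f (k + 1) ≤ f k + e k) (K : ℕ) :
    ∑ k ∈ range K, |f k - f (k + 1)| ≤ f 0 + 2 * S := by
  have h1 : ∑ k ∈ range K, |f k - f (k + 1)| ≤ ∑ k ∈ range K, ((f k - f (k + 1)) + 2 * e k) :=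
    sum_le_sum fun k _ => abs_sub_le_sub_add _ _ _ (hstep k) (he0 k)
  have h2 : ∑ k ∈ range K, ((f k - f (k + 1)) + 2 * e k) = (f 0 - f K) + 2 * ∑ k ∈ range K, e k := by
    rw [sum_add_distrib, sum_range_sub', mul_sum]
  rw [h2] at h1
  linarith [hf0 K, hS K]

/-! ## §2 Hermitian bookkeeping: entries from the real quadratic form (polarisation BY NAME from `VariationalGradientDuality`) -/

section Hermitian

variable {ι : Type*} [Fintype ι]

/-- POLARISATION, real part: `re (star v ⬝ᵥ H w) = (qform H (v+w) − qform H v − qform H w)∕2` for Hermitian `H` (leaf-03-g5's `qform_add_vec`, rearranged). [folklore] -/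
theorem re_sform_eq {H : Matrix ι ι ℂ} (hH : H.IsHermitian) (v w : ι → ℂ) :
    ((star v ⬝ᵥ (H *ᵥ w))).re = (qform H (v + w) - qform H v - qform H w) / 2 := by
  have h := qform_add_vec H hH v w
  linarith

/-- POLARISATION, imaginary part: `im (star v ⬝ᵥ H w) = (qform H v + qform H w − qform H (v + I•w))∕2` for Hermitian `H` (leaf-03-g5's `qform_add_smul_vec` at `c = I`).
[folklore] -/
theorem im_sform_eq {H : Matrix ι ι ℂ} (hH : H.IsHermitian) (v w : ι → ℂ) :
    ((star v ⬝ᵥ (H *ᵥ w))).im = (qform H v + qform H w - qform H (v + Complex.I • w)) / 2 := by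
  have h := qform_add_smul_vec H hH v w Complex.I
  have h1 : (Complex.I * (star v ⬝ᵥ (H *ᵥ w))).re = -((star v ⬝ᵥ (H *ᵥ w))).im := by
    rw [Complex.mul_re, Complex.I_re, Complex.I_im]; ring
  rw [h1, Complex.norm_I, one_pow, one_mul] at h
  linarith

/-- the entries are the form at the coordinate vectors: `H i j = star eᵢ ⬝ᵥ H eⱼ`. [folklore] -/
theorem apply_eq_sform [DecidableEq ι] (H : Matrix ι ι ℂ) (i j : ι) : H i j = (star (Pi.single i 1) ⬝ᵥ (H *ᵥ (Pi.single j 1))) := by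
  rw [← Pi.single_star, star_one, single_dotProduct, one_mul, Matrix.mulVec_single_one]
  rfl

/-- ENTRY IDENTITY (real part) for Hermitian `H`. [folklore] -/
theorem re_apply_eq [DecidableEq ι] {H : Matrix ι ι ℂ} (hH : H.IsHermitian) (i j : ι) :
    (H i j).re = (qform H (Pi.single i 1 + Pi.single j 1) - qform H (Pi.single i 1) - qform H (Pi.single j 1)) / 2 := by
  have h := re_sform_eq hH (Pi.single i 1) (Pi.single j 1)
  rwa [← apply_eq_sform] at h

/-- ENTRY IDENTITY (imaginary part) for Hermitian `H`. [folklore] -/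
theorem im_apply_eq [DecidableEq ι] {H : Matrix ι ι ℂ} (hH : H.IsHermitian) (i j : ι) :
    (H i j).im = (qform H (Pi.single i 1) + qform H (Pi.single j 1) - qform H (Pi.single i 1 + Complex.I • Pi.single j 1)) / 2 := by
  have h := im_sform_eq hH (Pi.single i 1) (Pi.single j 1)
  rwa [← apply_eq_sform] at h

/-- `qform` is continuous in the matrix (it is the continuous linear functional `qformL v`). [folklore] -/
theorem continuous_qform_left (v : ι → ℂ) : Continuous fun H : Matrix ι ι ℂ => qform H v :=
  (Literature.Analysis.Complex.qformL v).continuous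

end Hermitian

/-! ## §3 The monotone tower of Hermitian matrices -/

section Tower

variable {ι : Type*} [Fintype ι]

/-- **THE MONOTONE TOWER CONVERGES.**  Hermitian `X k` with nonnegative forms and one-sided brackets `qform (X (k+1)) v ≤ qform (X k) v + e k·N v` (`0 ≤ N`, `0 ≤ e`,
`Σ_{j<K} e j ≤ S`): there is `X∞` with `Tendsto X atTop (𝓝 X∞)`, `X∞` Hermitian, `0 ≤ qform X∞ v`, and `qform (X k) v → qform X∞ v` for every `v`.  No rate. [folklore] -/
theorem exists_tendsto_of_upper_brackets [DecidableEq ι] (X : ℕ → Matrix ι ι ℂ) (hX : ∀ k, (X k).IsHermitian) (hpos : ∀ k v, 0 ≤ qform (X k) v)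
    {N : (ι → ℂ) → ℝ} (hN : ∀ v, 0 ≤ N v) {e : ℕ → ℝ} {S : ℝ} (he0 : ∀ k, 0 ≤ e k) (hS : ∀ K, ∑ j ∈ range K, e j ≤ S)
    (hstep : ∀ k v, qform (X (k + 1)) v ≤ qform (X k) v + e k * N v) :
    ∃ Xlim : Matrix ι ι ℂ, Tendsto X atTop (𝓝 Xlim) ∧ Xlim.IsHermitian ∧ (∀ v, 0 ≤ qform Xlim v) ∧
      ∀ v, Tendsto (fun k => qform (X k) v) atTop (𝓝 (qform Xlim v)) := by
  -- every form value converges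
  have hconv : ∀ v, ∃ l : ℝ, Tendsto (fun k => qform (X k) v) atTop (𝓝 l) := fun v =>
    tendsto_of_le_add_summable (e := fun k => e k * N v) (S := S * N v) (fun k => hpos k v) (fun k => mul_nonneg (he0 k) (hN v))
      (fun K => by rw [← sum_mul]; exact mul_le_mul_of_nonneg_right (hS K) (hN v)) (fun k => hstep k v)
  choose G hG using hconv
  -- candidate limit from the entry identities
  let Xlim : Matrix ι ι ℂ := fun i j =>
    ⟨(G (Pi.single i 1 + Pi.single j 1) - G (Pi.single i 1) - G (Pi.single j 1)) / 2,
      (G (Pi.single i 1) + G (Pi.single j 1) - G (Pi.single i 1 + Complex.I • Pi.single j 1)) / 2⟩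
  have hT : Tendsto X atTop (𝓝 Xlim) := by
    refine tendsto_pi_nhds.2 fun i => tendsto_pi_nhds.2 fun j => ?_
    have hre : Tendsto (fun k => (X k i j).re) atTop (𝓝 (Xlim i j).re) := by
      have e1 : (fun k => (X k i j).re)
          = fun k => (qform (X k) (Pi.single i 1 + Pi.single j 1) - qform (X k) (Pi.single i 1) - qform (X k) (Pi.single j 1)) / 2 :=
        funext fun k => re_apply_eq (hX k) i j
      rw [e1]
      exact (((hG _).sub (hG _)).sub (hG _)).div_const 2
    have him : Tendsto (fun k => (X k i j).im) atTop (𝓝 (Xlim i j).im) := by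
      have e1 : (fun k => (X k i j).im)
          = fun k => (qform (X k) (Pi.single i 1) + qform (X k) (Pi.single j 1) - qform (X k) (Pi.single i 1 + Complex.I • Pi.single j 1)) / 2 :=
        funext fun k => im_apply_eq (hX k) i j
      rw [e1]
      exact (((hG _).add (hG _)).sub (hG _)).div_const 2
    have e2 : (fun k => X k i j) = fun k => ((X k i j).re : ℂ) + ((X k i j).im : ℂ) * Complex.I :=
      funext fun k => (Complex.re_add_im (X k i j)).symm
    rw [e2, ← Complex.re_add_im (Xlim i j)]
    exact ((Complex.continuous_ofReal.tendsto _).comp hre).add (((Complex.continuous_ofReal.tendsto _).comp him).mul_const _)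
  have hform : ∀ v, Tendsto (fun k => qform (X k) v) atTop (𝓝 (qform Xlim v)) := fun v =>
    ((continuous_qform_left v).tendsto Xlim).comp hT
  refine ⟨Xlim, hT, ?_, fun v => ge_of_tendsto' (hform v) fun k => hpos k v, hform⟩
  -- the limit is Hermitian (closed condition)
  have h1 : Tendsto (fun k => (X k)ᴴ) atTop (𝓝 Xlimᴴ) := (continuous_id.matrix_conjTranspose.tendsto Xlim).comp hT
  have h2 : (fun k => (X k)ᴴ) = X := funext fun k => (hX k).eq
  rw [h2] at h1
  exact tendsto_nhds_unique h1 hT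

/-- **BOUNDED TOTAL VARIATION OF THE FORMS** along the monotone tower: `Σ_{k<K} |qform (X k) v − qform (X (k+1)) v| ≤ qform (X 0) v + 2S·N v`. [folklore] -/
theorem tv_qform_le (X : ℕ → Matrix ι ι ℂ) (hpos : ∀ k v, 0 ≤ qform (X k) v)
    {N : (ι → ℂ) → ℝ} (hN : ∀ v, 0 ≤ N v) {e : ℕ → ℝ} {S : ℝ} (he0 : ∀ k, 0 ≤ e k) (hS : ∀ K, ∑ j ∈ range K, e j ≤ S)
    (hstep : ∀ k v, qform (X (k + 1)) v ≤ qform (X k) v + e k * N v) (v : ι → ℂ) (K : ℕ) :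
    ∑ k ∈ range K, |qform (X k) v - qform (X (k + 1)) v| ≤ qform (X 0) v + 2 * (S * N v) :=
  tv_le_of_le_add (e := fun k => e k * N v) (fun k => hpos k v) (fun k => mul_nonneg (he0 k) (hN v))
    (fun K => by rw [← sum_mul]; exact mul_le_mul_of_nonneg_right (hS K) (hN v)) (fun k => hstep k v) K

/-- **ENTRYWISE ABSOLUTELY SUMMABLE INCREMENTS** along the monotone tower: with `a := eᵢ + eⱼ`, `b := eᵢ + I•eⱼ`,
`Σ_{k<K} ‖X k i j − X (k+1) i j‖ ≤ (qform (X 0) a + qform (X 0) b)∕2 + qform (X 0) eᵢ + qform (X 0) eⱼ + S·(N a + N b + 2N eᵢ + 2N eⱼ)` — every entry of the tower has bounded total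
variation (hence `Σ_k ‖X_k − X_{k+1}‖ < ∞` in any norm on the finite-dimensional matrix space; no rate).  Mechanism: the entry identities applied to the Hermitian DIFFERENCES
`X k − X (k+1)`, `‖z‖ ≤ |re z| + |im z|`, and `tv_qform_le` at the four test vectors. [folklore] -/
theorem tv_entry_le [DecidableEq ι] (X : ℕ → Matrix ι ι ℂ) (hX : ∀ k, (X k).IsHermitian) (hpos : ∀ k v, 0 ≤ qform (X k) v)
    {N : (ι → ℂ) → ℝ} (hN : ∀ v, 0 ≤ N v) {e : ℕ → ℝ} {S : ℝ} (he0 : ∀ k, 0 ≤ e k) (hS : ∀ K, ∑ j ∈ range K, e j ≤ S)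
    (hstep : ∀ k v, qform (X (k + 1)) v ≤ qform (X k) v + e k * N v) (i j : ι) (K : ℕ) :
    ∑ k ∈ range K, ‖X k i j - X (k + 1) i j‖
      ≤ (qform (X 0) (Pi.single i 1 + Pi.single j 1) + qform (X 0) (Pi.single i 1 + Complex.I • Pi.single j 1)) / 2
          + qform (X 0) (Pi.single i 1) + qform (X 0) (Pi.single j 1)
        + S * (N (Pi.single i 1 + Pi.single j 1) + N (Pi.single i 1 + Complex.I • Pi.single j 1) + 2 * N (Pi.single i 1) + 2 * N (Pi.single j 1)) := by
  set a : ι → ℂ := Pi.single i 1 + Pi.single j 1 with ha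
  set b : ι → ℂ := Pi.single i 1 + Complex.I • Pi.single j 1 with hb
  set u : ι → ℂ := Pi.single i 1 with hu
  set w : ι → ℂ := Pi.single j 1 with hw
  -- the increments of the forms at a test vector
  set D : ℕ → (ι → ℂ) → ℝ := fun k v => qform (X k) v - qform (X (k + 1)) v with hD
  -- per level: the entry of the Hermitian difference from the entry identities
  have hk : ∀ k, ‖X k i j - X (k + 1) i j‖ ≤ (|D k a| + |D k b|) / 2 + |D k u| + |D k w| := fun k => by
    have hHd : (X k - X (k + 1)).IsHermitian := (hX k).sub (hX (k + 1))
    have e0 : X k i j - X (k + 1) i j = (X k - X (k + 1)) i j := rfl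
    have hre : ((X k - X (k + 1)) i j).re = (D k a - D k u - D k w) / 2 := by
      rw [re_apply_eq hHd, qform_sub, qform_sub, qform_sub]
    have him : ((X k - X (k + 1)) i j).im = (D k u + D k w - D k b) / 2 := by
      rw [im_apply_eq hHd, qform_sub, qform_sub, qform_sub]
    have h1 : |((X k - X (k + 1)) i j).re| ≤ (|D k a| + |D k u| + |D k w|) / 2 := by
      rw [hre, abs_div, abs_two]
      gcongr
      exact (abs_sub _ _).trans (add_le_add (abs_sub _ _) le_rfl)
    have h2 : |((X k - X (k + 1)) i j).im| ≤ (|D k u| + |D k w| + |D k b|) / 2 := by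
      rw [him, abs_div, abs_two]
      gcongr
      exact (abs_sub _ _).trans (add_le_add (abs_add_le _ _) le_rfl)
    rw [e0]
    have h3 := Complex.norm_le_abs_re_add_abs_im ((X k - X (k + 1)) i j)
    linarith
  -- total variation of the forms at the four test vectors
  have htv : ∀ v, ∑ k ∈ range K, |D k v| ≤ qform (X 0) v + 2 * (S * N v) := fun v =>
    tv_qform_le X hpos hN he0 hS hstep v K
  have hsum : ∑ k ∈ range K, ‖X k i j - X (k + 1) i j‖ ≤ ∑ k ∈ range K, ((|D k a| + |D k b|) / 2 + |D k u| + |D k w|) := sum_le_sum fun k _ => hk k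
  have hsplit : ∑ k ∈ range K, ((|D k a| + |D k b|) / 2 + |D k u| + |D k w|)
      = ((∑ k ∈ range K, |D k a|) + ∑ k ∈ range K, |D k b|) / 2 + ∑ k ∈ range K, |D k u| + ∑ k ∈ range K, |D k w| := by
    rw [sum_add_distrib, sum_add_distrib, ← sum_div, sum_add_distrib]
  rw [hsplit] at hsum
  have := htv a; have := htv b; have := htv u; have := htv w
  linarith

end Tower

end Summit.QuantumFields.BalabanUV.T4Continuum.VariationalMonotoneTower

end
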